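import Mathlib.Analysis.SpecialFunctions.OrdinaryHypergeometric
import Mathlib.Analysis.SpecialFunctions.Gamma.Basic
import Literature.NumberTheory.EllipticCurves.JacobiThetaDerivativeFormula
import Literature.Probability.RandomPlanarGeometry.CardyFunction
import HarnessLib

/-!
# Kleban–Zagier: crossing probabilities characterised by modular transformation properties

Topic `Literature/Probability/RandomPlanarGeometry` (companion to `CardyFunction.lean`, Cardy's
`F(η) = cardyFunction η`). NAMED FACTS (D-0014, `def … : Prop`, not asserted) transcribing
P. Kleban, D. Zagier, *Crossing probabilities and modular forms*, J. Stat. Phys. **113** (2003),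
431–454 (arXiv:math-ph/0209023), §5, Theorems 1 and 2 — the rigidity engine named by the crux
`RectValue` of route `CriticalPhenomena/CardyFormulaZ2/CardyMonotoneApproach`
(`stmt-CriticalPhenomena-5845`): a function of the aspect ratio `r` of a rectangle that is an (even)
"conformal block" and satisfies the exact duality `Π(1/r) = 1 - Π(r)` IS Cardy's horizontal crossing
probability.

Contents (grouping namespace `KlebanZagier`, the paper's own nomenclature, §5 p. 441: "the
nomenclature 'conformal' is only suggestive at this point"):

* `KlebanZagier.IsConformalBlock Π α a` — §5: "We will call a function `Π` on the positive real axis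
  a *conformal block* if it is expressible as a (real) power of `q̂ = e^{-πr}` times a power series
  in `q̂`. More precisely, if `Π(r) = ∑_{n=0}^∞ aₙ q̂^{n+α}` with `α ∈ ℝ` and `a₀ ≠ 0`, we call `Π(r)`
  a conformal block of dimension `α`." (`q̂^{n+α} = e^{-πr(n+α)}`; the series is required to converge
  to `Π r` for every `r > 0`.) `KlebanZagier.IsEvenConformalBlock` adds "`aₙ = 0` for `n` odd".
* `KlebanZagier.modularLambdaI r = λ(ir)` — §3: the cross-ratio of the corner-marked rectangle of
  aspect ratio `r` is "the classical result for the cross-ratio, namely `λ = λ(ir)` where `λ(τ)` is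
  the classical modular function ('Hauptmodul') for `Γ(2)`", `λ(τ) = (ϑ₂(τ)/ϑ₃(τ))⁴`
  (`= 16q̂ - 128q̂² + 704q̂³ - …`); typed with the tree's thetanulls
  `Literature.NumberTheory.EllipticCurves.JacobiThetaNull.theta2/theta3` (Mathlib `jacobiTheta₂`),
  real part taken on the imaginary axis where the quotient is real.
* `KlebanZagier.cardyPi r = Π_h(r) = F(λ(ir))` — §2, Cardy's formula (`Π_h(r) = (2π√3/Γ(1/3)³) λ^{1/3}
  ₂F₁(1/3,2/3;4/3;λ)`; the constant equals the tree's `3Γ(2/3)/Γ(1/3)²` by `Γ(1/3)Γ(2/3) = 2π/√3`),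
  and `KlebanZagier.genCardyFunction α η = F(η; κ)`, `α = 1 - 4/κ`, §3 (SLE_κ generalization of Cardy's formula)
  (`F(λ;κ) = Γ(2-8/κ)/(Γ(1-4/κ)Γ(2-4/κ)) λ^{1-4/κ} ₂F₁(1-4/κ, 4/κ; 2-4/κ; λ)`), so that the paper's
  `Π_h(r;α) := F(λ(ir); 4/(1-α))` is `genCardyFunction α (modularLambdaI r)`.
* `KlebanZagier.theorem1` — "**Theorem 1.** Let `Π(r)` be any function on the positive real axis such
  that (i) `Π(r)` is an even conformal block with dimension `α > 0`; (ii) `Π(1/r) = 1 - Π(r)`. Then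
  `α = 1/3` and `Π(r)` is Cardy's function."
* `KlebanZagier.theorem2` — "**Theorem 2.** Let `Π₁(r)` be any function on the positive real axis
  such that (i′) `Π₁(r)` is a conformal block of dimension `α ∈ ℝ` with coefficients `aₙ` of
  polynomial growth; (ii) `Π₁(1/r) = 1 - Π₁(r)`. Then `0 < α ≤ 1/2` and `Π₁(r) = Π_h(r;α)`, the
  generalized Cardy's function."

What is NOT here: no claim that any lattice crossing limit is a conformal block (that is the open
'tower structure' input of the route); no modular-forms API (the proofs, via `f = P′ ∈ M₂(Γ₁,v)` /
`M₂(Γ_θ,v)` and `η²⁴`, are not transcribed).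

## Mathlib

USED: `ordinaryHypergeometric` (`₂F₁`), `Real.Gamma`, `jacobiTheta₂` (through the tree's
`theta2`, `theta3`), `HasSum`, `Real.exp`. Mathlib has the modular group and level-one forms but no
`λ`-function and no theta-quotient identities (searched `modularLambda`, `lambda`, `Hauptmodul`).

## References

* P. Kleban, D. Zagier, *Crossing probabilities and modular forms*, J. Stat. Phys. 113 (2003),
  431–454, §§2–3, §5 Theorems 1–2. [KlebanZagier2003]
* J. Cardy, *Critical percolation in finite geometries*, J. Phys. A 25 (1992), L201–L206.
-/

open scoped Nat
open Complex (I)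

noncomputable section

namespace Literature.Probability.RandomPlanarGeometry.KlebanZagier

open Literature.NumberTheory.EllipticCurves.JacobiThetaNull (theta2 theta3)

/-- **Conformal block of dimension `α`** (Kleban–Zagier 2003, §5): `Π(r) = ∑_{n≥0} aₙ q̂^{n+α}` for
all `r > 0`, `q̂ = e^{-πr}`, real coefficients with `a₀ ≠ 0` (so `q̂^{n+α} = e^{-πr(n+α)}`).
[cite: KlebanZagier2003, §5 (definition before Theorem 1)] -/
def IsConformalBlock (P : ℝ → ℝ) (α : ℝ) (a : ℕ → ℝ) : Prop :=
  a 0 ≠ 0 ∧ ∀ r : ℝ, 0 < r →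
    HasSum (fun n : ℕ => a n * Real.exp (-(Real.pi * r * ((n : ℝ) + α)))) (P r)

/-- **Even conformal block** (Kleban–Zagier 2003, §5): a conformal block with `aₙ = 0` for `n` odd,
"so that `Π(r)` equals `q̂^α` times a power series in `q = q̂²`. Cardy's crossing probability `Π_h(r)`
satisfies this stronger condition." [cite: KlebanZagier2003, §5 (definition before Theorem 1)] -/
def IsEvenConformalBlock (P : ℝ → ℝ) (α : ℝ) (a : ℕ → ℝ) : Prop :=
  IsConformalBlock P α a ∧ ∀ n : ℕ, Odd n → a n = 0

/-- **The elliptic modular function on the imaginary axis**, `λ(ir) = (ϑ₂(ir)/ϑ₃(ir))⁴`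
(`ϑ₂(τ) = ∑ e^{πi(n+½)²τ}`, `ϑ₃(τ) = ∑ e^{πin²τ}`; real and in `(0,1)` for `r > 0`, `λ(i) = 1/2`,
`λ(ir) = 16q̂ - 128q̂² + 704q̂³ - …`, `q̂ = e^{-πr}`): by "the classical result for the cross-ratio"
it is the Cardy cross-ratio of the corner-marked rectangle of aspect ratio `r` (Kleban–Zagier 2003,
§3, first display). The real part is taken of a real number. [cite: KlebanZagier2003, §3] -/
def modularLambdaI (r : ℝ) : ℝ :=
  ((theta2 (I * (r : ℂ)) / theta3 (I * (r : ℂ))) ^ 4).re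

/-- **Cardy's horizontal crossing probability as a function of the aspect ratio**,
`Π_h(r) = (2π√3/Γ(1/3)³) λ^{1/3} ₂F₁(1/3,2/3;4/3;λ)`, `λ = λ(ir)` (Kleban–Zagier 2003, §2, Cardy's
formula, with `λ = λ(ir)` from §3); here through the tree's `cardyFunction` (same constant: `Γ(1/3)Γ(2/3) = 2π/√3`).
[cite: KlebanZagier2003, §2 (Cardy's formula)] -/
def cardyPi (r : ℝ) : ℝ :=
  cardyFunction (modularLambdaI r)

/-- **Generalized Cardy function** `F(η; κ)` of SLE_κ written with `α = 1 - 4/κ`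
(Kleban–Zagier 2003, §3, the SLE_κ crossing formula `F(λ;κ)`): `F(η;κ) = Γ(2-8/κ)/(Γ(1-4/κ)Γ(2-4/κ)) η^{1-4/κ}
₂F₁(1-4/κ, 4/κ; 2-4/κ; η)`, i.e. `Γ(2α)/(Γ(α)Γ(1+α)) η^α ₂F₁(α, 1-α; 1+α; η)`; `α = 1/3`
(`κ = 6`) gives `cardyFunction`. [cite: KlebanZagier2003, §3 (F(λ;κ))] -/
def genCardyFunction (α η : ℝ) : ℝ :=
  Real.Gamma (2 * α) / (Real.Gamma α * Real.Gamma (1 + α)) * η ^ α * ₂F₁ α (1 - α) (1 + α) η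

/-- **Kleban–Zagier, Theorem 1** (J. Stat. Phys. 113 (2003), §5): "Let `Π(r)` be any function on
the positive real axis such that (i) `Π(r)` is an even conformal block with dimension `α > 0`;
(ii) `Π(1/r) = 1 - Π(r)`. Then `α = 1/3` and `Π(r)` is Cardy's function." (Cardy's function of the
aspect ratio = `cardyPi`.) Grounds the value engine of
`Summit.CriticalPhenomena.CardyFormulaZ2.Theses.CardyMonotoneApproach.RectValue`; hypothesis (i) for
lattice limits is NOT known. [cite: KlebanZagier2003, §5 Theorem 1] -/
def theorem1 : Prop :=
  ∀ (P : ℝ → ℝ) (α : ℝ) (a : ℕ → ℝ), 0 < α → IsEvenConformalBlock P α a →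
    (∀ r : ℝ, 0 < r → P (1 / r) = 1 - P r) →
    α = 1 / 3 ∧ ∀ r : ℝ, 0 < r → P r = cardyPi r

/-- **Kleban–Zagier, Theorem 2** (J. Stat. Phys. 113 (2003), §5): "Let `Π₁(r)` be any function on
the positive real axis such that (i′) `Π₁(r)` is a conformal block of dimension `α ∈ ℝ` with
coefficients `aₙ` of polynomial growth; (ii) `Π₁(1/r) = 1 - Π₁(r)`. Then `0 < α ≤ 1/2` and
`Π₁(r) = Π_h(r;α)`, the generalized Cardy's function" (`Π_h(r;α) := F(λ(ir); 4/(1-α))`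
= `genCardyFunction α (modularLambdaI r)`). [cite: KlebanZagier2003, §5 Theorem 2] -/
def theorem2 : Prop :=
  ∀ (P : ℝ → ℝ) (α : ℝ) (a : ℕ → ℝ), IsConformalBlock P α a →
    (∃ C k : ℝ, ∀ n : ℕ, |a n| ≤ C * ((n : ℝ) + 1) ^ k) →
    (∀ r : ℝ, 0 < r → P (1 / r) = 1 - P r) →
    0 < α ∧ α ≤ 1 / 2 ∧ ∀ r : ℝ, 0 < r → P r = genCardyFunction α (modularLambdaI r)

end Literature.Probability.RandomPlanarGeometry.KlebanZagier

end
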